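import Mathlib
import HarnessLib
import Summits.QuantumFields.QCD.Theses.NestedDissectionSea
import Literature.MathematicalPhysics.QuantumFieldTheory.ConstructiveQFTWave0Proofs

/-!
# Triage scratch (crux-triage r1 k1, stmt-QuantumFields-13897): the typed first lemma
`CrossPlaneHankelNecessity` of card `cross-plane-hankel-rigidity` is FALSE AS TYPED (junk instance).

The Prop quantifies over every dimension `d` (and every compact group / representation). For
`d = 1` (also `d = 2`, or any `ρ` with constant plaquette energy, e.g. the trivial group or `N = 0`)
the stacked-pair functional `stackedPairs ρ c H` is identically `0` (no spatial plane `0 < i < j`),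
so the hypothesis "the tilted Wilson weight is reflection positive for all small `ε`" is just the
tree's Osterwalder–Seiler positivity `wilsonExpectation_reflectionPositive_holds`, true for EVERY
weight sequence `c` — while the conclusion (Hankel form of `c` positive semidefinite) fails for
`c ≡ -1`. Repair (obvious, recorded in TRIAGE): restrict to `d ≥ 3` (the card means `d = 4`,
`G = SU(3)` fundamental) — or better, conclude positivity only of the Hankel form PAIRED WITH the
OS Gram matrix of the plaquette energies, which is what the first-order argument actually gives.
The definitions below are copied verbatim from the card's `Sketch-ideator1.lean`.
-/

namespace Summit.QuantumFields.QCD.Cruxes.RobustYangMills.TriageK1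

open scoped BigOperators ComplexOrder
open MeasureTheory Filter Finset
open Literature.MathematicalPhysics.QuantumLattice Literature.MathematicalPhysics.AQFT
  Literature.MathematicalPhysics.QuantumFieldTheory

/-- (verbatim from Sketch-ideator1) -/
noncomputable def plaqEnergy {d L N : ℕ} {G : Type} [Group G]
    (ρ : G →* Matrix (Fin N) (Fin N) ℂ) (U : GaugeConfig d L G) (x : Site d L) (i j : Fin d) : ℝ :=
  (N : ℝ) - (ρ (plaquetteHolonomy U x i j)).trace.re

/-- (verbatim from Sketch-ideator1) -/
noncomputable def stackedPairs {d L N : ℕ} [NeZero d] [NeZero L] {G : Type} [Group G]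
    (ρ : G →* Matrix (Fin N) (Fin N) ℂ) (c : ℕ → ℝ) (H : ℕ) (U : GaugeConfig d L G) : ℝ :=
  ∑ x : Site d L, ∑ i : Fin d, ∑ j : Fin d, ∑ h ∈ Finset.range H,
    if (0 : Fin d) < i ∧ i < j then
      c h * plaqEnergy ρ U x i j * plaqEnergy ρ U (x + Pi.single 0 ((h : ℕ) : ZMod L)) i j
    else 0

/-- (verbatim from Sketch-ideator1) -/
def CrossPlaneHankelNecessity : Prop :=
  ∀ (d L N : ℕ) [NeZero d] [NeZero L] (G : Type) [Group G] [MeasurableSpace G]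
    [TopologicalSpace G] [IsTopologicalGroup G] [CompactSpace G] [BorelSpace G]
    (ρ : G →* Matrix (Fin N) (Fin N) ℂ) (β : ℝ) (c : ℕ → ℝ) (H : ℕ),
    Even L → 4 * H ≤ L → Continuous ρ → 0 < β →
    (∃ ε₀ : ℝ, 0 < ε₀ ∧ ∀ ε : ℝ, 0 ≤ ε → ε < ε₀ →
      ∀ F : GaugeConfig d L G → ℂ, Measurable F → (∃ C : ℝ, ∀ U, ‖F U‖ ≤ C) →
        IsPositiveTimeObservable F →
          0 ≤ wilsonExpectation ρ β fun U =>
            (starRingEnd ℂ) (F U.timeReflect) * F U *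
              ((Real.exp (ε * stackedPairs ρ c H U) : ℝ) : ℂ)) →
    ∀ v : ℕ → ℝ, (∀ a, H / 2 ≤ a → v a = 0) →
      0 ≤ ∑ a ∈ Finset.range H, ∑ a' ∈ Finset.range H, v a * v a' * c (a + a' + 1)

/-- In one dimension there is no spatial plane, so the stacked-pair functional vanishes. -/
theorem stackedPairs_eq_zero_of_dim_one {L N : ℕ} [NeZero L] {G : Type} [Group G]
    (ρ : G →* Matrix (Fin N) (Fin N) ℂ) (c : ℕ → ℝ) (H : ℕ) (U : GaugeConfig 1 L G) :
    stackedPairs ρ c H U = 0 := by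
  unfold stackedPairs
  refine Finset.sum_eq_zero fun x _ => Finset.sum_eq_zero fun i _ => Finset.sum_eq_zero fun j _ =>
    Finset.sum_eq_zero fun h _ => ?_
  have hij : ¬ ((0 : Fin 1) < i ∧ i < j) := by
    rintro ⟨-, h2⟩
    exact absurd (Subsingleton.elim i j ▸ h2) (lt_irrefl _)
  simp [hij]

/-- **The typed first lemma is false (junk instance `d = 1`).** -/
theorem not_CrossPlaneHankelNecessity : ¬ CrossPlaneHankelNecessity := by
  intro h
  let G := ↥(Matrix.specialUnitaryGroup (Fin 3) ℂ)
  let ρ : G →* Matrix (Fin 3) (Fin 3) ℂ := fundamentalRep (Fin 3)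
  have hρ : Continuous ρ := continuous_fundamentalRep _
  have hL : Even 8 := ⟨4, by norm_num⟩
  have key := h 1 8 3 G ρ 1 (fun _ => -1) 2 hL (by norm_num) hρ one_pos ?_
    (fun a => if a = 0 then 1 else 0) ?_
  · -- the Hankel form on v = δ₀ is c 1 = -1 < 0
    simp at key
    linarith
  · -- hypothesis: tilt by exp(ε · 0) = 1, i.e. plain Osterwalder–Seiler positivity (tree)
    refine ⟨1, one_pos, fun ε _ _ F hF hFb hFpos => ?_⟩
    have hfun : (fun U : GaugeConfig 1 8 G => (starRingEnd ℂ) (F U.timeReflect) * F U *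
          ((Real.exp (ε * stackedPairs ρ (fun _ => (-1 : ℝ)) 2 U) : ℝ) : ℂ)) =
        fun U => (starRingEnd ℂ) (F U.timeReflect) * F U := by
      funext U
      simp [stackedPairs_eq_zero_of_dim_one]
    rw [hfun]
    exact wilsonExpectation_reflectionPositive_holds ρ hL hρ zero_le_one F hF hFb hFpos
  · intro a ha
    have : a ≠ 0 := by omega
    simp [this]

end Summit.QuantumFields.QCD.Cruxes.RobustYangMills.TriageK1
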